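import Summits.BirchSwinnertonDyer.Rank1Residual.X11b.LocalH2Transition
import HarnessLib

/-!
# X11b, route R1 — `H²(K_v, E[p^∞]) = 0` at every finite place `v ∤ p` (towards (L10))

HONEST FRAMING (cell `b2b-bsdres`; verbatim framing in `LevelLiftingFromFiniteness.lean`): research
route R1 on X11b; X11b stays CONSTRUCTION-SHAPED; no label change; nothing booked; no named fact
minted (one definition with a body — the lift of a `2`-cocycle with torsion values — and theorems;
no `sorry`); CONDITIONAL on the cited `localEulerPoincareCharacteristic (K_v)` (Milne I 2.8, `hEP`).

## What is here (JSW17 §2.2.2 and proof of Lemma 3.3.3: "the local cohomology group `H²(K_w, W)` is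
## dual to `H⁰(K_w, T)`, and the latter is `0`")

* `map_two_map_two_eq_map_two` — functoriality of `H²(F, ·)` on intertwining maps (cocycle level);
* `liftTwoCocycle`, `exists_map_two_primaryInclusion_eq` — every class of `H²(F, E[p^∞])` (any
  `K`-field `F`) comes from `H²(F, E[p^N])` for some `N` (a continuous `2`-cocycle on the compact
  `Γ_F × Γ_F` with values in the discrete `E[p^∞]` takes `p^N`-torsion values and lifts through
  `E[p^N] ↪ E[p^∞]`);
* **`galoisCohomology_two_primary_eq_zero`**: `H²(K_v, E[p^∞]) = 0` at a finite place `v ∤ p` of a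
  number field, GIVEN Milne I 2.8 at `K_v`: push a class to a level `p^a` beyond the uniform exponent
  and apply the vanishing of the transition map `H²(K_v, E[p^a]) → H²(K_v, E[p^a·p^b])`
  (`exists_forall_map_two_torsionInclusion_eq_zero`, `LocalH2Transition`), through which
  `E[p^a] ↪ E[p^∞]` factors.

References: [JetchevSkinnerWan2017] §2.2.2, Lemma 3.3.3 (arXiv:1512.06894 pp. 6, 12);
[GreenbergLNM1716] §3; [MilneADT2006] I Thm. 2.8; [SerreGaloisCohomology1997] I §2.2–2.4.
-/

noncomputable section

open scoped Classical

open CategoryTheory Field NumberField IsDedekindDomain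
open Literature.NumberTheory.EllipticCurves
open Literature.NumberTheory.GaloisRepresentations
open scoped ContRepresentation

universe u

-- `H²` needs `LocallyCompactSpace Γ`; compactness of absolute Galois groups as a local instance.
attribute [local instance] absoluteGaloisGroup_compactSpace

namespace Summit.BirchSwinnertonDyer.Rank1Residual.X11b.Levels

/-! ## §1. Degree-`2` functoriality and lifting of `2`-cocycles through `E[p^N] ↪ E[p^∞]` -/

section Generic

variable {F : Type u} [Field F] {M₁ M₂ M₃ : Type u}
  [AddCommGroup M₁] [TopologicalSpace M₁] [DiscreteTopology M₁]
  [AddCommGroup M₂] [TopologicalSpace M₂] [DiscreteTopology M₂]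
  [AddCommGroup M₃] [TopologicalSpace M₃] [DiscreteTopology M₃]
  {ρ₁ : DiscreteGaloisModule F M₁} {ρ₂ : DiscreteGaloisModule F M₂} {ρ₃ : DiscreteGaloisModule F M₃}

/-- **`H²(g) ∘ H²(f) = H²(h)` when `g ∘ f = h` pointwise.** Serre, *Galois Cohomology*, I.§2.2.
[folklore] -/
theorem map_two_map_two_eq_map_two (f : ρ₁.toContRepresentation →ⁱL ρ₂.toContRepresentation)
    (g : ρ₂.toContRepresentation →ⁱL ρ₃.toContRepresentation)
    (h : ρ₁.toContRepresentation →ⁱL ρ₃.toContRepresentation) (hcomp : ∀ a : M₁, g (f a) = h a)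
    (x : galoisCohomology ρ₁ 2) :
    galoisCohomology.map g 2 (galoisCohomology.map f 2 x) = galoisCohomology.map h 2 x := by
  obtain ⟨c, rfl⟩ := twoCocycleClass_surjective _ x
  change cohomologyMap (DiscreteGaloisModule.homOfIntertwining g) 2
      (cohomologyMap (DiscreteGaloisModule.homOfIntertwining f) 2 (twoCocycleClass _ c)) =
    cohomologyMap (DiscreteGaloisModule.homOfIntertwining h) 2 (twoCocycleClass _ c)
  rw [cohomologyMap_twoCocycleClass, cohomologyMap_twoCocycleClass, cohomologyMap_twoCocycleClass]
  exact congrArg (twoCocycleClass _) (Subtype.ext (ContinuousMap.ext fun στ ↦ hcomp (c.1 στ)))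

variable {A B : Type u} [AddCommGroup A] [TopologicalSpace A] [DiscreteTopology A]
  [AddCommGroup B] [TopologicalSpace B] [DiscreteTopology B]
  {ρA : DiscreteGaloisModule F A} {ρB : DiscreteGaloisModule F B}

/-- **Lifting a `2`-cocycle with `n`-torsion values through an injective `i : A ↪ B` with
`range i ⊇ B[n]`** (values `i⁻¹(c(σ, τ))`; the cocycle identity is checked after `i`).
Serre, *Galois Cohomology*, I.§2.2. [folklore] -/
def liftTwoCocycle (i : ρA.toContRepresentation →ⁱL ρB.toContRepresentation) (n : ℕ)
    (hrange : ∀ b : B, n • b = 0 → ∃ a : A, i a = b) (hinj : Function.Injective i)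
    (c : contTwoCocycles ρB.toTopRep) (hc : ∀ στ, n • c.1 στ = 0) : contTwoCocycles ρA.toTopRep :=
  ⟨⟨fun στ ↦ liftTorsion i n hrange (c.1 στ),
      (continuous_of_discreteTopology (f := liftTorsion i n hrange)).comp c.1.continuous⟩,
    fun σ τ υ ↦ by
      apply hinj
      change i (ρA.toTopRep.ρ σ (liftTorsion i n hrange (c.1 (τ, υ))) +
          liftTorsion i n hrange (c.1 (σ, τ * υ))) =
        i (liftTorsion i n hrange (c.1 (σ * τ, υ)) + liftTorsion i n hrange (c.1 (σ, τ)))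
      have hi : ∀ a, i (ρA.toTopRep.ρ σ a) = ρB σ (i a) := fun a ↦ i.isIntertwining σ a
      rw [map_add, map_add, hi, apply_liftTorsion (hc _), apply_liftTorsion (hc _),
        apply_liftTorsion (hc _), apply_liftTorsion (hc _)]
      exact c.2 σ τ υ⟩

/-- `H²(i) [c̃] = [c]` for the lifted cocycle. [folklore] -/
theorem map_two_twoCocycleClass_liftTwoCocycle
    (i : ρA.toContRepresentation →ⁱL ρB.toContRepresentation) (n : ℕ)
    (hrange : ∀ b : B, n • b = 0 → ∃ a : A, i a = b) (hinj : Function.Injective i)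
    (c : contTwoCocycles ρB.toTopRep) (hc : ∀ στ, n • c.1 στ = 0) :
    galoisCohomology.map i 2 (twoCocycleClass _ (liftTwoCocycle i n hrange hinj c hc)) =
      twoCocycleClass _ c := by
  change cohomologyMap (DiscreteGaloisModule.homOfIntertwining i) 2 _ = _
  rw [cohomologyMap_twoCocycleClass]
  exact congrArg (twoCocycleClass _) (Subtype.ext (ContinuousMap.ext fun στ ↦
    apply_liftTorsion (hc στ)))

end Generic

section Primary

variable {K : Type u} [Field K] (W : WeierstrassCurve K) (p : ℕ) (E : Type u) [Field E] [Algebra K E]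

/-- **Every class of `H²(E, E[p^∞])` comes from some finite level `H²(E, E[p^N])`** (any `K`-field
`E`): a continuous `2`-cocycle on the compact `Γ_E × Γ_E` with values in the discrete `p`-primary
`E[p^∞]` has a common killing exponent `p^N` (`exists_pow_smul_apply_eq_zero`) and lifts through
`E[p^N] ↪ E[p^∞]`. [cite: GreenbergLNM1716, §3 Lemma 3.3 (p. 87)] -/
theorem exists_map_two_primaryInclusion_eq
    (Z : galoisCohomology (GaloisRep.restrictField E (LocBridge.primaryGaloisModule W p)) 2) :
    ∃ (N : ℕ) (z : galoisCohomology
      (GaloisRep.restrictField E (W.torsionGaloisModule ((p ^ N : ℕ) : ℤ))) 2),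
      galoisCohomology.map ((primaryInclusion W p N).restrictField E) 2 z = Z := by
  obtain ⟨c, rfl⟩ := twoCocycleClass_surjective _ Z
  have hB : ∀ Q : W.geomPrimaryTorsion p, ∃ k : ℕ, p ^ k • Q = 0 := fun Q ↦
    (AddCommGroup.mem_primaryComponent.mp Q.2).imp fun k hk ↦
      Subtype.ext (by rw [AddSubmonoidClass.coe_nsmul, hk, ZeroMemClass.coe_zero])
  obtain ⟨N, hN⟩ := exists_pow_smul_apply_eq_zero c.1 fun στ ↦ hB (c.1 στ)
  exact ⟨N, twoCocycleClass _ (liftTwoCocycle ((primaryInclusion W p N).restrictField E) (p ^ N)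
      (exists_primaryInclusion_restrictField_eq_of_nsmul_eq_zero W p N E)
      (primaryInclusion_restrictField_injective W p N E) c hN),
    map_two_twoCocycleClass_liftTwoCocycle _ _ _ _ c hN⟩

end Primary

/-! ## §2. `H²(K_v, E[p^∞]) = 0` at `v ∤ p` -/

section Vanishing

variable {K : Type u} [Field K] [NumberField K] (W : WeierstrassCurve K) [W.IsElliptic] (p : ℕ)
  [Fact p.Prime] (v : HeightOneSpectrum (𝓞 K))

/-- **`H²(K_v, E[p^∞]) = 0` at every finite place `v ∤ p`** of a number field (for an elliptic
curve), GIVEN Milne I Thm. 2.8 at `K_v` (`hEP`, cited) — JSW17 §2.2.2 / Lemma 3.3.3 ("`H²(K_w, W)`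
is dual to `H⁰(K_w, T)`, and the latter is `0`"), here by counting: a class comes from some
`H²(K_v, E[p^N])` (`exists_map_two_primaryInclusion_eq`), is pushed to a level `p^a` beyond the
uniform torsion exponent (`E[p^N] ↪ E[p^a] ↪ E[p^a·p^b] ↪ E[p^∞]`, functoriality), and the middle
transition map vanishes (`exists_forall_map_two_torsionInclusion_eq_zero`).
[cite: JetchevSkinnerWan2017, §2.2.2 and Lemma 3.3.3 (arXiv:1512.06894 pp. 6, 12)]
[cite: MilneADT2006, Ch. I §2, Thm. 2.8 and Cor. 2.3] -/
theorem galoisCohomology_two_primary_eq_zero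
    (hEP : localEulerPoincareCharacteristic (v.adicCompletion K)) (hpv : (p : 𝓞 K) ∉ v.asIdeal)
    (Z : galoisCohomology (GaloisRep.restrictField (v.adicCompletion K)
      (LocBridge.primaryGaloisModule W p)) 2) : Z = 0 := by
  obtain ⟨e, he⟩ := exists_forall_map_two_torsionInclusion_eq_zero W p v hEP hpv
  obtain ⟨N, z, rfl⟩ := exists_map_two_primaryInclusion_eq W p (v.adicCompletion K) Z
  -- levels `a = N + e + 1 ≥ e`, `b = e + 1 ≥ e`
  set a := N + e + 1 with ha
  set b := e + 1 with hb
  have hNa : ((p ^ N : ℕ) : ℤ) ∣ ((p ^ a : ℕ) : ℤ) :=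
    Int.natCast_dvd_natCast.mpr (Nat.pow_dvd_pow p (by omega))
  have hab : ((p ^ a : ℕ) : ℤ) * ((p ^ b : ℕ) : ℤ) ∣ ((p ^ (a + b) : ℕ) : ℤ) :=
    ⟨1, by rw [mul_one, ← Nat.cast_mul, ← pow_add]⟩
  -- `ι_N = ι_{a+b} ∘ T₂ ∘ T₁ ∘ T₀` pointwise (all are the identity on points)
  set T₀ := (W.torsionInclusion hNa).restrictField (v.adicCompletion K)
  set T₁ := (W.torsionInclusion (Dvd.intro ((p ^ b : ℕ) : ℤ) rfl :
    ((p ^ a : ℕ) : ℤ) ∣ ((p ^ a : ℕ) : ℤ) * ((p ^ b : ℕ) : ℤ))).restrictField (v.adicCompletion K)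
  set T₂ := (W.torsionInclusion hab).restrictField (v.adicCompletion K)
  have h1 : galoisCohomology.map ((primaryInclusion W p N).restrictField (v.adicCompletion K)) 2 z =
      galoisCohomology.map ((primaryInclusion W p a).restrictField (v.adicCompletion K)) 2
        (galoisCohomology.map T₀ 2 z) :=
    (map_two_map_two_eq_map_two
      (ρ₁ := GaloisRep.restrictField (v.adicCompletion K) (W.torsionGaloisModule ((p ^ N : ℕ) : ℤ)))
      (ρ₂ := GaloisRep.restrictField (v.adicCompletion K) (W.torsionGaloisModule ((p ^ a : ℕ) : ℤ)))
      (ρ₃ := GaloisRep.restrictField (v.adicCompletion K) (LocBridge.primaryGaloisModule W p))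
      T₀ _ _ (fun Q ↦ Subtype.ext rfl) z).symm
  have h2 : ∀ y : galoisCohomology (GaloisRep.restrictField (v.adicCompletion K)
      (W.torsionGaloisModule ((p ^ a : ℕ) : ℤ))) 2,
      galoisCohomology.map ((primaryInclusion W p a).restrictField (v.adicCompletion K)) 2 y =
        galoisCohomology.map ((primaryInclusion W p (a + b)).restrictField (v.adicCompletion K)) 2
          (galoisCohomology.map T₂ 2 (galoisCohomology.map T₁ 2 y)) := fun y ↦ by
    rw [map_two_map_two_eq_map_two
      (ρ₁ := GaloisRep.restrictField (v.adicCompletion K) (W.torsionGaloisModule ((p ^ a : ℕ) : ℤ)))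
      (ρ₂ := GaloisRep.restrictField (v.adicCompletion K)
        (W.torsionGaloisModule (((p ^ a : ℕ) : ℤ) * ((p ^ b : ℕ) : ℤ))))
      (ρ₃ := GaloisRep.restrictField (v.adicCompletion K)
        (W.torsionGaloisModule ((p ^ (a + b) : ℕ) : ℤ)))
      T₁ T₂ ((W.torsionInclusion (dvd_trans (Dvd.intro _ rfl) hab)).restrictField (v.adicCompletion K))
      (fun Q ↦ Subtype.ext rfl) y]
    exact (map_two_map_two_eq_map_two
      (ρ₁ := GaloisRep.restrictField (v.adicCompletion K) (W.torsionGaloisModule ((p ^ a : ℕ) : ℤ)))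
      (ρ₂ := GaloisRep.restrictField (v.adicCompletion K)
        (W.torsionGaloisModule ((p ^ (a + b) : ℕ) : ℤ)))
      (ρ₃ := GaloisRep.restrictField (v.adicCompletion K) (LocBridge.primaryGaloisModule W p))
      _ _ _ (fun Q ↦ Subtype.ext rfl) y).symm
  rw [h1, h2, he a b (by omega) (by omega) (by omega) (by omega), map_zero, map_zero]

/-- The same in the `toLocal` form of the Selmer-structure files. [cite: JetchevSkinnerWan2017, §2.2.2 (arXiv:1512.06894 p. 6)] -/
theorem subsingleton_galoisCohomology_two_primary_toLocal
    (hEP : localEulerPoincareCharacteristic (v.adicCompletion K)) (hpv : (p : 𝓞 K) ∉ v.asIdeal) :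
    Subsingleton (galoisCohomology ((LocBridge.primaryGaloisModule W p).toLocal (Sum.inr v)) 2) :=
  ⟨fun x y ↦ by
    rw [galoisCohomology_two_primary_eq_zero W p v hEP hpv x,
      galoisCohomology_two_primary_eq_zero W p v hEP hpv y]⟩

end Vanishing

end Summit.BirchSwinnertonDyer.Rank1Residual.X11b.Levels

end
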